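import Summits.NavierStokesRegularity.FluidComputer.PalasekTowerRegisterGlobalSmallData
import Summits.NavierStokesRegularity.FluidComputer.PalasekTowerRegisterGlobalBase
import Summits.NavierStokesRegularity.FluidComputer.PalasekTowerHeredityWitnessWindow

/-!
# Negative lane of the crux `EpisodeBase` (stmt-NavierStokesRegularity-19179): the ∀-over-hosts first-episode
# placeholders are FALSE modulo the small-data classical engine and a tiny anchored host

Cell `ns-blowup`, seat `ns-blowup-ecbridge-4` (g3; GROUP C «BRIDGE SUPPORT», route `PalasekTowerBreakdown`).
LABEL: E–C typing (KERNEL negative-lane lemma, everything PROVED; the two hypotheses are the typed `Prop`s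
of `PalasekTowerRegisterGlobalSmallData.lean`). WHAT THIS IS NOT: not Navier–Stokes evidence and NOT a
refutation of the crux `EpisodeBaseG` (which is ∃-form and untouched): it retires the ∀-over-level-`0`-hosts
PLACEHOLDER stub `stub_first_episodeR : FirstEpisodeR` of the line `Cruxes/EpisodeBase/Lines/birth.lean`
(registered v3, planner g18 2026-08-26 09:19Z «host preparation CLOSED, first episode OPEN pending the
NAMED S*») MODULO two named hypotheses, as WELCOMED by the planner's RULING on refuter4's K-ROW K56
(2026-08-26 09:45Z, (r3) ADOPTED: «the Negative-lane plan `firstEpisodeR_false_of_<H>` is WELCOME as a landed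
lemma under `Theorems/EpisodeBase/Negative/` — a proved ¬FirstEpisodeR (mod H) costs the ∃-crux nothing and
retires the placeholder honestly»).

## The argument (refuter4 K56 (C), with the anchor repaired by this seat)

Let `H₁ := SmallDataClassicalEngine 1` (Kato's small-data forced theory with classical output — UNPROVED
typed hypothesis) and `H₂ := TinyAnchoredHosts` (the register admits globally anchored level-`0` hosts of
arbitrarily small scale-invariant size — construction target of this seat's companion files). Assume
`FirstEpisodeR` (tree form, `PalasekTowerRegisterGlobalBase`, p418527). Take `ε` from `H₁`, and from `H₂`
a pinned rigid quiet schedule `S` of radius `R ≤ δ` with a registered level-`0` stage `s₀` whose readout slice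
`u₀ := s₀.u(τ₀)` has `‖u₀‖₃ ≤ δ`, for the `δ = δ(ε, w₀, Y₀, Y₁)` below. `FirstEpisodeR` hands an admissible
push `g` — Clay class, `‖g‖ ≤ c₄ Y₀ ≤ Y₀` on the first window `[τ₀, τ₁]` (`c₄ ≤ c₁ = 1`), confined to
`B̄(0, R)` by the re-forced schedule's pins — and a registered LEVEL-`1` stage `s₁` of `S.reforce g` with
`s₁.u = s₀.u` on `[0, τ₀]`. On the first window (`τ₁ − τ₀ = w₀`, rigidity) the engine's dimensionless size is
`≤ δ + w₀^{1/2} Y₀ δ² + w₀^{3/4} Y₀ δ^{3/2} ≤ δ K ≤ ε` (`δ ≤ 1`), so `H₁` gives a BOUNDED classical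
finite-energy solution `v` from `u₀` at `τ₀` with `‖v(τ₁, ·)‖ ≤ ε⁻¹ δ K w₀^{-1/2} ≤ Y₁/2`; the tree's
W14-free uniqueness `velocity_eq_of_bounded_classical_Icc` (forced Serrin–Masuda, p421753/p432xxx) identifies
`s₁.u = v` on `[τ₀, τ₁]`; but `s₁`'s level-`1` floor demands a point with `‖s₁.u(τ₁, x)‖ ≥ c₁ Y₁ = Y₁` —
contradiction. Hence `H₁ → H₂ → ¬FirstEpisodeR`, and (tree implication `FirstEpisode.firstEpisodeR`)
`H₁ → H₂ → ¬FirstEpisode` (`= ¬HeredityAt 0`).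

References: T. Kato, Math. Z. 187 (1984) 471–480 [cite: Kato1984, Thm. 1–4]; H. Sohr, *The Navier–Stokes
equations* (2001), Ch. V Thm. 1.5.1 (forced Serrin–Masuda) [cite: Sohr2001, Ch. V Thm. 1.5.1];
S. Palasek, arXiv:2605.13827 §3.3–§4 [cite: Palasek2026ElementaryModel, §3.3].
-/

noncomputable section

namespace Summit.NavierStokesRegularity.EpisodeBaseNegative

open Set MeasureTheory Filter Topology Function Real
open scoped ENNReal ContDiff NNReal

open Literature.Analysis.FluidPDE
open Summit.NavierStokesRegularity.FluidComputer.PalasekTowerClayBridge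

/-- The arithmetic of the smallness choice: for `K = 1 + √w Y + w^{3/4} Y` (`w, Y > 0`) and
`δ := min 1 (min (ε/K) (ε Y' √w / (2K)))` one has `0 < δ ≤ 1`, `δ K ≤ ε` and `ε⁻¹ (δ K) (√w)⁻¹ ≤ Y'/2`.
[folklore] -/
private theorem smallness_choice {ε w Y Y' : ℝ} (hε : 0 < ε) (hw : 0 < w) (hY : 0 < Y) (hY' : 0 < Y') :
    ∃ δ : ℝ, 0 < δ ∧ δ ≤ 1 ∧
      δ * (1 + Real.sqrt w * Y + w ^ (3 / 4 : ℝ) * Y) ≤ ε ∧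
      ε⁻¹ * (δ * (1 + Real.sqrt w * Y + w ^ (3 / 4 : ℝ) * Y)) * Real.sqrt (1 / w) ≤ Y' / 2 := by
  set K : ℝ := 1 + Real.sqrt w * Y + w ^ (3 / 4 : ℝ) * Y with hK
  have hK1 : 1 ≤ K := by
    have h1 : 0 ≤ Real.sqrt w * Y := by positivity
    have h2 : 0 ≤ w ^ (3 / 4 : ℝ) * Y := by positivity
    linarith
  have hK0 : 0 < K := by linarith
  have hsw : 0 < Real.sqrt w := Real.sqrt_pos.2 hw
  set δ : ℝ := min 1 (min (ε / K) (ε * Y' * Real.sqrt w / (2 * K))) with hδ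
  have hδ0 : 0 < δ := lt_min one_pos (lt_min (by positivity) (by positivity))
  refine ⟨δ, hδ0, min_le_left _ _, ?_, ?_⟩
  · have h1 : δ ≤ ε / K := (min_le_right _ _).trans (min_le_left _ _)
    rwa [le_div_iff₀ hK0] at h1
  · have h2 : δ ≤ ε * Y' * Real.sqrt w / (2 * K) := (min_le_right _ _).trans (min_le_right _ _)
    have h3 : δ * K ≤ ε * Y' * Real.sqrt w / 2 := by
      rw [le_div_iff₀ (by positivity)] at h2
      linarith
    rw [Real.sqrt_div' _ hw.le, Real.sqrt_one]
    rw [show ε⁻¹ * (δ * K) * (1 / Real.sqrt w) = (δ * K) / (ε * Real.sqrt w) by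
      field_simp]
    rw [div_le_iff₀ (by positivity)]
    nlinarith

/-- **THE ∀-RE-FORCING PLACEHOLDER IS FALSE MODULO THE ENGINE AND A TINY HOST.** If Kato's small-data
classical engine holds at unit viscosity (`SmallDataClassicalEngine 1`, typed hypothesis) and the register
admits tiny anchored level-`0` hosts (`TinyAnchoredHosts`, construction target), then `FirstEpisodeR` — «every
registered level-`0` host is pushed to a registered level-`1` stage by some admissible window force» — fails:
a tiny host and every admissible push are small data on the first window, the unique bounded classical
continuation stays below `Y₁/2 < c₁ Y₁` at `τ₁`, and the level-`1` floor cannot be met.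
[cite: Kato1984, Thm. 1–4] [cite: Sohr2001, Ch. V Thm. 1.5.1] -/
theorem firstEpisodeR_false_of_engine_of_tinyHosts
    (hE : SmallDataClassicalEngine 1) (hH : TinyAnchoredHosts) : ¬ FirstEpisodeR := by
  intro hF
  obtain ⟨ε, hε, hEng⟩ := hE
  -- the fixed data of the first window
  set w : ℝ := TowerRates.wide.window 0 with hw
  have hw0 : 0 < w := TowerRates.wide.window_pos 0
  have hY0 : 0 < TowerRates.wide.Y 0 := TowerRates.Y_pos _ 0
  have hY1 : 0 < TowerRates.wide.Y 1 := TowerRates.Y_pos _ 1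
  obtain ⟨δ, hδ0, hδ1, hδK, hδout⟩ :=
    smallness_choice hε hw0 hY0 hY1
  -- a tiny host of size `δ`
  obtain ⟨S, hP, hR, hQ, hrad0, hradδ, s₀, hsupp, hL3⟩ := hH δ hδ0
  -- the push and the level-1 stage handed by `FirstEpisodeR`
  obtain ⟨g, h₁, h₂, h₃, h₄, -, hP', -, -, s₁, hs₁⟩ := hF S hP hR hQ s₀
  -- notation
  set u₀ := s₀.u (S.τ 0) with hu₀
  have hτ0 : 0 < S.τ 0 := S.τ_pos 0
  have hτ01 : S.τ 0 < S.τ 1 := S.τ_lt_succ 0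
  have hwin : S.τ 1 - S.τ 0 = w := hR.τ_one_sub_τ_zero
  have hc₁ : S.c₁ = 1 := hR.c₁_eq
  have hc₄0 : 0 ≤ S.c₄ := S.c₄_nonneg
  have hc₄1 : S.c₄ ≤ 1 := by rw [← hc₁]; exact S.c₄_le
  -- the datum at `τ₀` is smooth, compactly supported, divergence free, of `L³`-norm `≤ δ`
  have hmem0 : S.τ 0 ∈ Icc 0 (S.τ 0) := ⟨hτ0.le, le_rfl⟩
  have hu₀s : ContDiff ℝ ∞ u₀ := s₀.classical.contDiff_velocity hmem0
  have hu₀d : VectorCalculus.IsDivFree u₀ := s₀.classical.divFree _ hmem0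
  have hL3' : (eLpNorm u₀ 3 volume).toReal ≤ δ := by
    have hne : eLpNorm u₀ 3 volume ≠ ⊤ := ne_top_of_le_ne_top ENNReal.ofReal_ne_top hL3
    have := (ENNReal.toReal_le_toReal hne ENNReal.ofReal_ne_top).2 hL3
    rwa [ENNReal.toReal_ofReal hδ0.le] at this
  -- the push on the first window: `‖g‖ ≤ c₄ Y₀ ≤ Y₀`, confined to the ball of radius `≤ δ`
  set M : ℝ := S.c₄ * TowerRates.wide.Y 0 with hM
  have hM0 : 0 ≤ M := mul_nonneg hc₄0 hY0.le
  have hMY : M ≤ TowerRates.wide.Y 0 := by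
    have := mul_le_mul_of_nonneg_right hc₄1 hY0.le
    rwa [one_mul] at this
  have hgM : ∀ t ∈ Icc (S.τ 0) (S.τ 1), ∀ x, ‖g t x‖ ≤ M := fun t ht x => h₄ 0 t ht x
  have hgconf : ∀ t x, S.radius < ‖x‖ → g t x = 0 := by
    intro t x hx
    have := hP'.force_confined t x (by simpa using hx)
    simpa using this
  -- the dimensionless size on the first window is `≤ δ K ≤ ε`
  have hR2 : S.radius ^ 2 ≤ δ := by
    have h1 : S.radius ^ 2 ≤ δ ^ 2 := pow_le_pow_left₀ hrad0 hradδ 2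
    nlinarith
  have hR32 : S.radius ^ (3 / 2 : ℝ) ≤ δ := by
    have h1 : S.radius ^ (3 / 2 : ℝ) ≤ δ ^ (3 / 2 : ℝ) :=
      Real.rpow_le_rpow hrad0 hradδ (by norm_num)
    have h2 : δ ^ (3 / 2 : ℝ) ≤ δ ^ (1 : ℝ) :=
      Real.rpow_le_rpow_of_exponent_ge hδ0 hδ1 (by norm_num)
    rw [Real.rpow_one] at h2
    exact h1.trans h2
  have hsize : (eLpNorm u₀ 3 volume).toReal / 1 +
      Real.sqrt (S.τ 1 - S.τ 0) * M * S.radius ^ 2 / (1 : ℝ) ^ (3 / 2 : ℝ) +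
      (S.τ 1 - S.τ 0) ^ (3 / 4 : ℝ) * M * S.radius ^ (3 / 2 : ℝ) / (1 : ℝ) ^ (5 / 4 : ℝ) ≤
      δ * (1 + Real.sqrt w * TowerRates.wide.Y 0 + w ^ (3 / 4 : ℝ) * TowerRates.wide.Y 0) := by
    rw [Real.one_rpow, Real.one_rpow, div_one, div_one, div_one, hwin]
    have hsw : 0 ≤ Real.sqrt w := Real.sqrt_nonneg _
    have hw34 : 0 ≤ w ^ (3 / 4 : ℝ) := Real.rpow_nonneg hw0.le _
    have h2 : Real.sqrt w * M * S.radius ^ 2 ≤ Real.sqrt w * TowerRates.wide.Y 0 * δ := by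
      have := mul_le_mul (mul_le_mul_of_nonneg_left hMY hsw) hR2 (sq_nonneg _) (by positivity)
      exact this
    have h3 : w ^ (3 / 4 : ℝ) * M * S.radius ^ (3 / 2 : ℝ) ≤ w ^ (3 / 4 : ℝ) * TowerRates.wide.Y 0 * δ := by
      have := mul_le_mul (mul_le_mul_of_nonneg_left hMY hw34) hR32
        (Real.rpow_nonneg hrad0 _) (by positivity)
      exact this
    nlinarith
  have hsizeε : (eLpNorm u₀ 3 volume).toReal / 1 +
      Real.sqrt (S.τ 1 - S.τ 0) * M * S.radius ^ 2 / (1 : ℝ) ^ (3 / 2 : ℝ) +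
      (S.τ 1 - S.τ 0) ^ (3 / 4 : ℝ) * M * S.radius ^ (3 / 2 : ℝ) / (1 : ℝ) ^ (5 / 4 : ℝ) ≤ ε :=
    hsize.trans hδK
  -- the engine: a bounded classical finite-energy solution on the first window from `u₀`
  obtain ⟨v, q, hv, hv0, ⟨B, hB⟩, hEv, hvτ1⟩ := hEng (S.τ 0) (S.τ 1) hτ0.le hτ01 u₀ g S.radius M
    hu₀s hsupp hu₀d h₁ h₂ hrad0 hgconf hM0 hgM hsizeε
  -- the level-1 stage of the re-forced schedule, restricted to the first window
  have hs₁c : IsClassicalNSSolutionOn (Icc (S.τ 0) (S.τ 1)) 1 g s₁.u s₁.p := by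
    have h := s₁.classical
    simp only [Schedule.reforce_τ, Schedule.reforce_f] at h
    exact h.mono (Icc_subset_Icc_left hτ0.le) (uniqueDiffOn_Icc hτ01)
  have hs₁E : ∃ C : ℝ≥0∞, C < ⊤ ∧ ∀ t ∈ Icc (S.τ 0) (S.τ 1), ∫⁻ x, ‖s₁.u t x‖ₑ ^ 2 ≤ C := by
    obtain ⟨C, hC, hb⟩ := s₁.energy
    refine ⟨C, hC, fun t ht => hb t ?_⟩
    simp only [Schedule.reforce_τ]
    exact ⟨hτ0.le.trans ht.1, ht.2⟩
  have h0 : s₁.u (S.τ 0) = v (S.τ 0) := by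
    rw [hv0, hu₀]
    exact (hs₁ (S.τ 0) hmem0).1
  -- W14-free uniqueness: the stage IS the engine's bounded solution on the window
  have heq : ∀ t ∈ Icc (S.τ 0) (S.τ 1), s₁.u t = v t :=
    velocity_eq_of_bounded_classical_Icc one_pos hτ0.le hτ01 h₁ h₂ hv hEv hB hs₁c hs₁E h0
  -- the engine's bound at `τ₁`: below `Y₁ / 2`
  have hbound : ∀ x, ‖s₁.u (S.τ 1) x‖ ≤ TowerRates.wide.Y 1 / 2 := by
    intro x
    rw [heq (S.τ 1) ⟨hτ01.le, le_rfl⟩]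
    refine (hvτ1 x).trans ?_
    have hK0 : 0 ≤ (eLpNorm u₀ 3 volume).toReal / 1 +
        Real.sqrt (S.τ 1 - S.τ 0) * M * S.radius ^ 2 / (1 : ℝ) ^ (3 / 2 : ℝ) +
        (S.τ 1 - S.τ 0) ^ (3 / 4 : ℝ) * M * S.radius ^ (3 / 2 : ℝ) / (1 : ℝ) ^ (5 / 4 : ℝ) := by
      rw [Real.one_rpow, Real.one_rpow, div_one, div_one, div_one]
      have : 0 ≤ Real.sqrt (S.τ 1 - S.τ 0) := Real.sqrt_nonneg _
      have : 0 ≤ (S.τ 1 - S.τ 0) ^ (3 / 4 : ℝ) := Real.rpow_nonneg (by linarith) _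
      have : 0 ≤ S.radius ^ (3 / 2 : ℝ) := Real.rpow_nonneg hrad0 _
      positivity
    have hsq : 0 ≤ Real.sqrt (1 / (S.τ 1 - S.τ 0)) := Real.sqrt_nonneg _
    calc ε⁻¹ * ((eLpNorm u₀ 3 volume).toReal / 1 +
          Real.sqrt (S.τ 1 - S.τ 0) * M * S.radius ^ 2 / (1 : ℝ) ^ (3 / 2 : ℝ) +
          (S.τ 1 - S.τ 0) ^ (3 / 4 : ℝ) * M * S.radius ^ (3 / 2 : ℝ) / (1 : ℝ) ^ (5 / 4 : ℝ)) *
          Real.sqrt (1 / (S.τ 1 - S.τ 0))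
        ≤ ε⁻¹ * (δ * (1 + Real.sqrt w * TowerRates.wide.Y 0 + w ^ (3 / 4 : ℝ) * TowerRates.wide.Y 0)) *
          Real.sqrt (1 / (S.τ 1 - S.τ 0)) := by
          have := mul_le_mul_of_nonneg_left hsize (inv_pos.2 hε).le
          exact mul_le_mul_of_nonneg_right this hsq
      _ = ε⁻¹ * (δ * (1 + Real.sqrt w * TowerRates.wide.Y 0 + w ^ (3 / 4 : ℝ) * TowerRates.wide.Y 0)) *
          Real.sqrt (1 / w) := by rw [hwin]
      _ ≤ TowerRates.wide.Y 1 / 2 := hδout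
  -- … contradicting the level-1 floor of the stage
  obtain ⟨x, -, hfl⟩ := s₁.floor 1 le_rfl
  simp only [Schedule.reforce_τ, Schedule.reforce_c₁, hc₁, one_mul] at hfl
  have := hbound x
  linarith

/-- **… hence the ∀-schedule first-episode trap `FirstEpisode` (`= HeredityAt 0`) is false under the same
hypotheses** (`FirstEpisode → FirstEpisodeR`, tree lemma `FirstEpisode.firstEpisodeR`). [cite: Palasek2026ElementaryModel, §3.3] -/
theorem firstEpisode_false_of_engine_of_tinyHosts
    (hE : SmallDataClassicalEngine 1) (hH : TinyAnchoredHosts) : ¬ FirstEpisode :=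
  fun h => firstEpisodeR_false_of_engine_of_tinyHosts hE hH h.firstEpisodeR

/-- … and so is `HeredityAt 0` (by name). [cite: Palasek2026ElementaryModel, §3.3] -/
theorem heredityAt_zero_false_of_engine_of_tinyHosts
    (hE : SmallDataClassicalEngine 1) (hH : TinyAnchoredHosts) : ¬ HeredityAt 0 :=
  fun h => firstEpisode_false_of_engine_of_tinyHosts hE hH
    (firstEpisode_iff_heredityAt_zero.2 h)

end Summit.NavierStokesRegularity.EpisodeBaseNegative

end
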